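import Literature.Analysis.FluidPDE.PassiveVectorTensorPropagatorWeightedDecay
import HarnessLib

/-!
# The two-weight dissipation floor for the ADJOINT propagator: `‖U(s,s′)† y‖² ≤ ‖y‖² − ½ Σ_k min(1, x_k)·|ŷ(k)|²`

Analysis/FluidPDE file (pure proof layer; no definitions, no named facts).  The adjoint of `U s s′` is the concrete propagator of the
backward problem on the window (carrier `r ↦ −b(s′ − r)`, tensor `majorTranspose 𝔸`, horizon `s′ − s`; `IsPropagator.adjoint_eq`), which is
again an `IsPropagator` family (`isPropagator_propagator`) with the SAME ellipticity window, the same `L^∞` bound, and — slice by slice — the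
same continuity and Lipschitz constant (reflection in time is measure preserving, `ae_restrict_Ioo_reversed_window`; negation of the field
changes neither).  Hence the forward floor `IsPropagator.norm_sq_apply_le_sub_tsum` applies verbatim:
* `ae_restrict_Ioo_reversed_window` — an a.e. property on `(0,T)` holds a.e. along `r ↦ t − r` on `(0, t − s)` for `0 ≤ s`, `t ≤ T`;
* `IsPropagator.norm_sq_adjoint_apply_le_half` / `…_le_sub_tsum` — the two floors for `(U s s′)†`.

Consumer: cell `ad-ideate`, K1L_D `stmt-AnomalousDissipation-27980`, W3-E `stub_effectiveFrameEnergyL` clause (i) for `T = (Um s s′)†`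
(crux memo `Lines/onelevel-W3E-k3l-lyapunov.md` §6, P4c).

## Mathlib / tree search
Tree: `IsPropagator.adjoint_eq`, `isPropagator_propagator` (PassiveVectorTensorPropagatorUnique); `memLp_top_stLift_reversed_window`,
`ae_isWeaklyDivFree_reversed_window` (…PropagatorDuality); `nearIso_majorTranspose_iff` (PassiveVectorTensor);
`IsPropagator.norm_sq_apply_le_half/…_le_sub_tsum`, `half_add_sum_le_sub_tsum` (…PropagatorWeightedDecay, p680241).
Mathlib: `Measure.measurePreserving_sub_left`, `MeasurePreserving.restrict_preimage`, `QuasiMeasurePreserving.ae`.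

## References
* A. Pazy, *Semigroups of Linear Operators* (1983), Ch. 1 §1.10 (adjoint semigroup), Ch. 5 §5.1. [`Pazy1983`]
* R. Temam, *Navier–Stokes Equations* (1984), Ch. III §1 Lemma 1.2. [`Temam1984`]
-/

noncomputable section

open MeasureTheory Set Filter Function TopologicalSpace UnitAddTorus
open scoped ENNReal NNReal InnerProductSpace Topology

namespace Literature.Analysis.FluidPDE

namespace Torus

variable {d : Type*} [Fintype d] [DecidableEq d] [Nonempty d]
variable {T : ℝ} {𝔸 : Visc4 d} {lo hi : ℝ} {b : ℝ → UnitAddTorus d → EuclideanSpace ℝ d}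
variable {U : ℝ → ℝ → (Lp (EuclideanSpace ℝ d) 2 (volume : Measure (UnitAddTorus d)) →L[ℝ]
  Lp (EuclideanSpace ℝ d) 2 (volume : Measure (UnitAddTorus d)))}

omit [Fintype d] [DecidableEq d] [Nonempty d] in
/-- **A.e. properties along the reversed window**: if `P τ` for a.e. `τ ∈ (0,T)`, then `P (t − r)` for a.e. `r ∈ (0, t − s)` whenever
`0 ≤ s`, `t ≤ T` (reflection is measure preserving). [cite: Temam1984, Ch. III §1 Lemma 1.2] -/
theorem ae_restrict_Ioo_reversed_window {P : ℝ → Prop} (h : ∀ᵐ τ ∂(volume.restrict (Ioo 0 T)), P τ) {s t : ℝ} (hs : 0 ≤ s)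
    (htT : t ≤ T) : ∀ᵐ r ∂(volume.restrict (Ioo 0 (t - s))), P (t - r) := by
  have h1 : ∀ᵐ τ ∂(volume.restrict (Ioo s t)), P τ := ae_restrict_of_ae_restrict_of_subset (Ioo_subset_Ioo hs htT) h
  have hmp : MeasurePreserving (fun r : ℝ => t - r) (volume.restrict (Ioo 0 (t - s))) (volume.restrict (Ioo s t)) := by
    have h := (Measure.measurePreserving_sub_left (volume : Measure ℝ) t).restrict_preimage (measurableSet_Ioo (a := s) (b := t))
    have hpre : (fun r : ℝ => t - r) ⁻¹' Ioo s t = Ioo 0 (t - s) := by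
      ext r; simp only [mem_preimage, mem_Ioo]; constructor <;> rintro ⟨h1, h2⟩ <;> constructor <;> linarith
    rwa [hpre] at h
  exact hmp.quasiMeasurePreserving.ae h1

namespace IsPropagator

/-- **Two-weight floor for the adjoint propagator** (`½`-form): `‖(U s s′)† y‖² ≤ ½ (‖y‖² + Σ_{k∈F} ω_k |ŷ(k)|²)`.
[cite: Pazy1983, Ch. 1 §1.10] [cite: Temam1984, Ch. III §1 Lemma 1.2] -/
theorem norm_sq_adjoint_apply_le_half (hU : IsPropagator T b 𝔸 U) (h𝔸 : NearIso 𝔸 lo hi) (hlo : 0 < lo)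
    (hb : MemLp (FunctionSpaces.Torus.stLift b) ∞ (volume.restrict (Ioo 0 T ×ˢ univ)))
    (hbdiv : ∀ᵐ τ ∂(volume.restrict (Ioo 0 T)), FunctionSpaces.Torus.IsWeaklyDivFree (b τ))
    (hbc : ∀ᵐ τ ∂(volume.restrict (Ioo 0 T)), Continuous (b τ))
    {L : ℝ} (hL0 : 0 ≤ L)
    (hbL : ∀ᵐ τ ∂(volume.restrict (Ioo 0 T)), ∀ x y, ‖b τ x - b τ y‖ ≤ L * ‖FunctionSpaces.Torus.reprc (x - y)‖)
    {s s' : ℝ} (hs : 0 ≤ s) (hss' : s < s') (hs'T : s' ≤ T)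
    (F : Finset (d → ℤ)) (ω : (d → ℤ) → ℝ) (hωF : ∀ k, k ∉ F → ω k = 0) (hω0 : ∀ k, 0 ≤ ω k) (hω1 : ∀ k, ω k ≤ 1)
    (hωlo : ∀ k, Real.log 2 * (1 - ω k) ≤ 4 / 5 * (8 * Real.pi ^ 2 * lo * FunctionSpaces.Torus.freqNormSq k * (s' - s)))
    (hM : L * (∫ z, ‖FunctionSpaces.Torus.reprc z‖ ^ 3 * ∑ a, |FunctionSpaces.Torus.fluxKernelGrad F ω a z|) ≤ 4 / 5 * lo)
    (y : Lp (EuclideanSpace ℝ d) 2 (volume : Measure (UnitAddTorus d))) :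
    ‖ContinuousLinearMap.adjoint (U s s') y‖ ^ 2 ≤ 1 / 2 * (‖y‖ ^ 2 +
      ∑ k ∈ F, ω k * ‖mFourierCoeff (FunctionSpaces.EuclideanSpace.complexify ∘ (y : UnitAddTorus d → EuclideanSpace ℝ d)) k‖ ^ 2) := by
  rw [hU.adjoint_eq h𝔸 hlo hb hbdiv hs hss' hs'T]
  have h𝔸' := (nearIso_majorTranspose_iff 𝔸 lo hi).2 h𝔸
  have hb' := memLp_top_stLift_reversed_window (T := T) (b := b) hb hs hs'T
  have hbdiv' := ae_isWeaklyDivFree_reversed_window (T := T) (b := b) hbdiv hs hs'T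
  have hV := isPropagator_propagator h𝔸' hlo hb' hbdiv'
  have hbc' : ∀ᵐ r ∂(volume.restrict (Ioo 0 (s' - s))), Continuous (fun x => -b (s' - r) x) := by
    filter_upwards [ae_restrict_Ioo_reversed_window (P := fun τ => Continuous (b τ)) hbc hs hs'T] with r hr
    exact hr.neg
  have hbL' : ∀ᵐ r ∂(volume.restrict (Ioo 0 (s' - s))), ∀ x y, ‖-b (s' - r) x - -b (s' - r) y‖ ≤
      L * ‖FunctionSpaces.Torus.reprc (x - y)‖ := by
    filter_upwards [ae_restrict_Ioo_reversed_window
      (P := fun τ => ∀ x y, ‖b τ x - b τ y‖ ≤ L * ‖FunctionSpaces.Torus.reprc (x - y)‖) hbL hs hs'T] with r hr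
    intro x y
    rw [show -b (s' - r) x - -b (s' - r) y = -(b (s' - r) x - b (s' - r) y) by abel, norm_neg]
    exact hr x y
  have hωlo' : ∀ k, Real.log 2 * (1 - ω k) ≤ 4 / 5 * (8 * Real.pi ^ 2 * lo * FunctionSpaces.Torus.freqNormSq k * (s' - s - 0)) :=
    fun k => by rw [sub_zero]; exact hωlo k
  exact hV.norm_sq_apply_le_half h𝔸' hlo hb' hbdiv' hbc' hL0 hbL' le_rfl (sub_pos.2 hss') le_rfl F ω hωF hω0 hω1 hωlo' hM y

/-- **THE DISSIPATION FLOOR OF THE ADJOINT PROPAGATOR**: `‖(U s s′)† y‖² ≤ ‖y‖² − ½ Σ'_k min(1, x_k)·|ŷ(k)|²` for rates `x_k ≥ 0` with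
`min(1, x_k) ≤ 1 − ω_k`. [cite: Pazy1983, Ch. 1 §1.10] [cite: Temam1984, Ch. III §1 Lemma 1.2] -/
theorem norm_sq_adjoint_apply_le_sub_tsum (hU : IsPropagator T b 𝔸 U) (h𝔸 : NearIso 𝔸 lo hi) (hlo : 0 < lo)
    (hb : MemLp (FunctionSpaces.Torus.stLift b) ∞ (volume.restrict (Ioo 0 T ×ˢ univ)))
    (hbdiv : ∀ᵐ τ ∂(volume.restrict (Ioo 0 T)), FunctionSpaces.Torus.IsWeaklyDivFree (b τ))
    (hbc : ∀ᵐ τ ∂(volume.restrict (Ioo 0 T)), Continuous (b τ))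
    {L : ℝ} (hL0 : 0 ≤ L)
    (hbL : ∀ᵐ τ ∂(volume.restrict (Ioo 0 T)), ∀ x y, ‖b τ x - b τ y‖ ≤ L * ‖FunctionSpaces.Torus.reprc (x - y)‖)
    {s s' : ℝ} (hs : 0 ≤ s) (hss' : s < s') (hs'T : s' ≤ T)
    (F : Finset (d → ℤ)) (ω : (d → ℤ) → ℝ) (hωF : ∀ k, k ∉ F → ω k = 0) (hω0 : ∀ k, 0 ≤ ω k) (hω1 : ∀ k, ω k ≤ 1)
    (hωlo : ∀ k, Real.log 2 * (1 - ω k) ≤ 4 / 5 * (8 * Real.pi ^ 2 * lo * FunctionSpaces.Torus.freqNormSq k * (s' - s)))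
    (hM : L * (∫ z, ‖FunctionSpaces.Torus.reprc z‖ ^ 3 * ∑ a, |FunctionSpaces.Torus.fluxKernelGrad F ω a z|) ≤ 4 / 5 * lo)
    (x : (d → ℤ) → ℝ) (hx0 : ∀ k, 0 ≤ x k) (hx : ∀ k, min 1 (x k) ≤ 1 - ω k)
    (y : Lp (EuclideanSpace ℝ d) 2 (volume : Measure (UnitAddTorus d))) :
    ‖ContinuousLinearMap.adjoint (U s s') y‖ ^ 2 ≤ ‖y‖ ^ 2 - 1 / 2 * ∑' k : d → ℤ, min 1 (x k) *
        ‖mFourierCoeff (FunctionSpaces.EuclideanSpace.complexify ∘ (y : UnitAddTorus d → EuclideanSpace ℝ d)) k‖ ^ 2 :=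
  (hU.norm_sq_adjoint_apply_le_half h𝔸 hlo hb hbdiv hbc hL0 hbL hs hss' hs'T F ω hωF hω0 hω1 hωlo hM y).trans
    (half_add_sum_le_sub_tsum F ω hωF x hx0 hx y)

end IsPropagator

end Torus

end Literature.Analysis.FluidPDE

end
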